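import Summits.BirchSwinnertonDyer.BirchSwinnertonDyer.Theorems.BiquadraticEisensteinDescentManinDatumSupercuspidalCMInertOfSexticDictionary
import Summits.BirchSwinnertonDyer.BirchSwinnertonDyer.Theorems.BiquadraticEisensteinDescentManinDatumSupercuspidalCMInertSexticCharacterAxiomsJZero
import HarnessLib

set_option linter.dupNamespace false -- `Summit.BirchSwinnertonDyer.BirchSwinnertonDyer.Theorems.…` (summit = sub, D-0017)
set_option autoImplicit false

/-!
# Crux `ManinDatumSupercuspidalCMInert` (stmt-BirchSwinnertonDyer-20111, BED r605), stub `stub_S5` — the sextic dictionary interface in the EXACT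
# currency of bed-w2 g11's `SexticTwistThetaDictionaryInert.lSeries_twist_eq_thetaLFunction_five`: `5`-factor `Φ₅` on `(ℤ/5)²` in `ρ`-coordinates,
# MULTIPLICATIVE (`Φ₅ 0 = 0`, `Φ₅((d₁ρ + d₂)(d′₁ρ + d′₂)) = Φ₅(d)Φ₅(d′)`, `Φ₅(−1, 1) = Φ₅(1 − ρ) = (−ρ²)^e`), weight `W(y) = Φ₅(y₂, y₁ + y₂)Ψ(y)`
# (width seat `bsd-wall-cm-bed-w3` g11; theorems only; route cone; `--supports 20111`, helper)

Route `BiquadraticEisensteinDescent` (cell `pub/bsd-wall`). Third form of this seat's D4 interface (after `…OfSexticDictionary` — five axioms — and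
`…OfSexticDictionaryMulChar` — multiplicative in `ω₃`-coordinates): the five axioms of `(·/5)₆^e` are obtained from multiplicativity in
`ρ`-coordinates and the one value at `1 − ρ` by bed-w1 g8's `…SexticCharacterAxiomsJZero.character_axioms_of_mul` (p648689), so that the E-side's
export (bed-w2 g11: `sexticCharFive_props`, `thetaWeight_five_split`, `lSeries_twist_eq_thetaLFunction_five`, constant `4^s/2`, i.e. `u = 2`, `N = 1`
at `s = 1`) discharges the hypothesis `hdictAllRho` below by `refine ⟨…⟩` with no coordinate change and no axiom bookkeeping:

* `oddLValue_sextic_of_dictionary_mulCharRho` — the `f`-free odd `5`-integrality of `L(E^k ⊗ χ̄, 1)τ(χ)/(iΩ⁻)` modulo the dictionary, `ρ`-multiplicative form;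
* ★ `H5_of_sexticDictionary_mulCharRho` — `hdictAllRho → H₅` (VERBATIM hypothesis of `…OfH5.maninDatumSupercuspidalCMInert_of_H5`);
* ★ `maninDatumSupercuspidalCMInert_of_sexticDictionary_mulCharRho` — `hdictAllRho → ManinDatumSupercuspidalCMInert` (crux BY NAME).

HONEST FRAMING: `hdictAllRho` (the sextic theta dictionary with the `5`-factor split off, over the FULL range of `H₅`, including the good-at-`2`
class `k = 16u`, `u ≡ 1 (4)`) is NOT proved here; the crux, Manin's conjecture and BSD are NOT proved by this. No definition, no named fact, no `sorry`;
axioms standard.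
-/

noncomputable section

open scoped Classical
open Complex PeriodPair
open Literature.NumberTheory.EllipticCurves
open Literature.NumberTheory.LFunctions
open Summit.BirchSwinnertonDyer.BirchSwinnertonDyer.Theses.BiquadraticEisensteinDescent

namespace Summit.BirchSwinnertonDyer.BirchSwinnertonDyer.Theorems.BiquadraticEisensteinDescentManinDatumSupercuspidalCMInertOfSexticDictionaryMulCharRho

open Summit.BirchSwinnertonDyer.BirchSwinnertonDyer.Theorems.BiquadraticEisensteinDescentManinDatumSupercuspidalCMInertModelLValuesSexticOfDictionary
  (oddLValue_sextic_of_dictionary)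
open Summit.BirchSwinnertonDyer.BirchSwinnertonDyer.Theorems.BiquadraticEisensteinDescentManinDatumSupercuspidalCMInertSexticCharacterAxiomsJZero
  (character_axioms_of_mul)
open Summit.BirchSwinnertonDyer.BirchSwinnertonDyer.Theorems.BiquadraticEisensteinDescentManinDatumSupercuspidalCMInertOfH5
  (maninDatumSupercuspidalCMInert_of_H5)

/-- **The `f`-free odd twisted-value statement for `E^k : y² = x³ + k` at `5`, MODULO the sextic theta dictionary with a `ρ`-multiplicative `5`-factor.**
As `…ModelLValuesSexticOfDictionary.oddLValue_sextic_of_dictionary`, with the five axioms of `Φ₅` replaced by `Φ₅ 0 = 0`, multiplicativity in the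
`ρ`-coordinates `d ↔ d₁ρ + d₂` of `𝔽₂₅` and `Φ₅(−1, 1) = (−ρ²)^e` (bed-w1 g8's `character_axioms_of_mul`).
[cite: Rubin1999, §7.4 Prop. 7.15] [cite: IrelandRosen1982, Ch. 14 §2] -/
theorem oddLValue_sextic_of_dictionary_mulCharRho (k : ℤ) (hk : k ≠ 0) {e : ℕ} (he1 : 1 ≤ e) (he5 : e ≤ 5) {k₁ : ℕ}
    (hke : k.natAbs = 5 ^ e * k₁)
    {m : ℕ} [NeZero m] (χ : DirichletCharacter ℂ m) {M' : ℕ} [NeZero M'] (hcop : Nat.Coprime 5 M')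
    (Φ₅ : ZMod 5 × ZMod 5 → ℂ) (hΦ₅0 : Φ₅ 0 = 0)
    (hΦ₅mul : ∀ d d' : ZMod 5 × ZMod 5, Φ₅ (d.1 * d'.2 + d.2 * d'.1 - d.1 * d'.1, d.2 * d'.2 - d.1 * d'.1) = Φ₅ d * Φ₅ d')
    (hΦ₅gen : Φ₅ (-1, 1) = (-(UpperHalfPlane.ρ : ℂ) ^ 2) ^ e)
    (Ψ W : ℤ × ℤ → ℂ) (hΨ : ∀ y z : ℤ × ℤ, Ψ (y.1 + M' * z.1, y.2 + M' * z.2) = Ψ y)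
    (hΨint : ∀ y : ℤ × ℤ, IsIntegral ℤ (Ψ y))
    (hW : ∀ y : ℤ × ℤ, W y = Φ₅ ((y.2 : ZMod 5), ((y.1 + y.2 : ℤ) : ZMod 5)) * Ψ y)
    (L : ℂ → ℂ) (hLdiff : Differentiable ℂ L)
    (hL : ∀ s : ℂ, 2 < s.re →
      L s = LSeries (fun n : ℕ ↦ χ⁻¹ (n : ZMod m) * ((⟨0, 0, 0, 0, (k : ℚ)⟩ : WeierstrassCurve ℚ).LFunction n : ℂ)) s)
    {u : ℂ} (hu : IsIntegral ℤ u) {N : ℕ} (hN : ¬ 5 ∣ N)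
    (hL1 : L 1 = u / N * BinaryTheta.thetaLFunction 3 (2 * (5 * M')) 1 (-((Real.sqrt (3 : ℕ) : ℂ) * I))
      (QuadOrder.parityLift W) 1) :
    ∃ L : ℂ → ℂ, Differentiable ℂ L ∧
      (∀ s : ℂ, 2 < s.re →
        L s = LSeries (fun n : ℕ ↦ χ⁻¹ (n : ZMod m) * ((⟨0, 0, 0, 0, (k : ℚ)⟩ : WeierstrassCurve ℚ).LFunction n : ℂ)) s) ∧
      ∃ s : ℕ, ¬ 5 ∣ s ∧ IsIntegral ℤ ((s : ℂ) * (gaussSum χ (ZMod.stdAddChar (N := m)) * L 1 /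
        (Complex.I * ((⟨0, 0, 0, 0, (k : ℚ)⟩ : WeierstrassCurve ℚ).imaginaryPeriodRat : ℂ)))) := by
  obtain ⟨hone, hneg, hrho, hgen'⟩ := character_axioms_of_mul Φ₅ hΦ₅mul hΦ₅gen
  exact oddLValue_sextic_of_dictionary k hk he1 he5 hke χ hcop Φ₅ hΦ₅0 hone hneg hrho hgen' Ψ W hΨ hΨint hW L hLdiff hL hu hN hL1

/-- ★ **`H₅` from the sextic theta dictionary, `ρ`-multiplicative form** — the hypothesis `hdictAllRho` is the announced export of
`Literature/…/SexticTwistThetaDictionaryInert.lSeries_twist_eq_thetaLFunction_five` packaged over the range of `H₅` (with `u = 2`, `N = 1`,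
`L(s) = (4^s/2)·Θ(s)`). [cite: Rubin1999, §7.4 Prop. 7.15] [cite: IrelandRosen1990, Ch. 18 §7] -/
theorem H5_of_sexticDictionary_mulCharRho
    (hdictAllRho : ∀ (k : ℤ), k ≠ 0 → (5 : ℤ) ∣ k → (∀ q : ℕ, q.Prime → ¬ ((q : ℤ) ^ 6 ∣ k)) →
      ∀ (ℓ : ℕ) [NeZero ℓ], ℓ.Prime → 5 ≤ ℓ → ¬ (ℓ : ℤ) ∣ k → ¬ 4 ∣ ℓ - 1 → ¬ 5 ∣ ℓ - 1 →
        IsSquare ((5 : ℕ) : ZMod ℓ) →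
      ∀ χ : DirichletCharacter ℂ ℓ, χ.Odd →
      ∃ (e k₁ M' : ℕ) (_ : NeZero M') (Φ₅ : ZMod 5 × ZMod 5 → ℂ) (Ψ W : ℤ × ℤ → ℂ) (L : ℂ → ℂ) (u : ℂ) (N : ℕ),
        1 ≤ e ∧ e ≤ 5 ∧ k.natAbs = 5 ^ e * k₁ ∧ Nat.Coprime 5 M' ∧
        Φ₅ 0 = 0 ∧
        (∀ d d' : ZMod 5 × ZMod 5, Φ₅ (d.1 * d'.2 + d.2 * d'.1 - d.1 * d'.1, d.2 * d'.2 - d.1 * d'.1) = Φ₅ d * Φ₅ d') ∧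
        Φ₅ (-1, 1) = (-(UpperHalfPlane.ρ : ℂ) ^ 2) ^ e ∧
        (∀ y z : ℤ × ℤ, Ψ (y.1 + M' * z.1, y.2 + M' * z.2) = Ψ y) ∧ (∀ y : ℤ × ℤ, IsIntegral ℤ (Ψ y)) ∧
        (∀ y : ℤ × ℤ, W y = Φ₅ ((y.2 : ZMod 5), ((y.1 + y.2 : ℤ) : ZMod 5)) * Ψ y) ∧
        Differentiable ℂ L ∧
        (∀ s : ℂ, 2 < s.re →
          L s = LSeries (fun n : ℕ ↦ χ⁻¹ (n : ZMod ℓ) * ((⟨0, 0, 0, 0, (k : ℚ)⟩ : WeierstrassCurve ℚ).LFunction n : ℂ)) s) ∧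
        IsIntegral ℤ u ∧ ¬ 5 ∣ N ∧
        L 1 = u / N * BinaryTheta.thetaLFunction 3 (2 * (5 * M')) 1 (-((Real.sqrt (3 : ℕ) : ℂ) * I))
          (QuadOrder.parityLift W) 1) :
    ∀ (k : ℤ), k ≠ 0 → (5 : ℤ) ∣ k → (∀ q : ℕ, q.Prime → ¬ ((q : ℤ) ^ 6 ∣ k)) →
      ∀ (ℓ : ℕ) [NeZero ℓ], ℓ.Prime → 5 ≤ ℓ → ¬ (ℓ : ℤ) ∣ k → ¬ 4 ∣ ℓ - 1 → ¬ 5 ∣ ℓ - 1 →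
        IsSquare ((5 : ℕ) : ZMod ℓ) →
      ∀ χ : DirichletCharacter ℂ ℓ, χ.Odd →
      ∃ L : ℂ → ℂ, Differentiable ℂ L ∧
        (∀ s : ℂ, 2 < s.re → L s = LSeries (fun n : ℕ ↦ χ⁻¹ (n : ZMod ℓ) *
          ((⟨0, 0, 0, 0, (k : ℚ)⟩ : WeierstrassCurve ℚ).LFunction n : ℂ)) s) ∧
        ∃ s : ℕ, ¬ 5 ∣ s ∧ IsIntegral ℤ ((s : ℂ) * (gaussSum χ (ZMod.stdAddChar (N := ℓ)) * L 1 /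
          (Complex.I * ((⟨0, 0, 0, 0, (k : ℚ)⟩ : WeierstrassCurve ℚ).imaginaryPeriodRat : ℂ)))) := by
  intro k hk h5k h6 ℓ _ hℓ h5ℓ hℓk h4 h5 hsq χ hχ
  obtain ⟨e, k₁, M', _, Φ₅, Ψ, W, L, u, N, he1, he5, hke, hcop, hΦ₅0, hΦ₅mul, hΦ₅gen, hΨ, hΨint, hW, hLdiff, hL, hu, hN, hL1⟩ :=
    hdictAllRho k hk h5k h6 ℓ hℓ h5ℓ hℓk h4 h5 hsq χ hχ
  exact oddLValue_sextic_of_dictionary_mulCharRho k hk he1 he5 hke χ hcop Φ₅ hΦ₅0 hΦ₅mul hΦ₅gen Ψ W hΨ hΨint hW L hLdiff hL hu hN hL1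

/-- ★ **`hdictAllRho → ManinDatumSupercuspidalCMInert`** (crux 20111 BY NAME from the sextic theta dictionary in the E-side's own currency; the
`j = 1728` half, the CM core, the periods and the assembly are tree theorems). [cite: IrelandRosen1990, Ch. 18 §7] [cite: Rubin1999, §7.4 Prop. 7.15]
[cite: Manin1972, Thm. 1.6] -/
theorem maninDatumSupercuspidalCMInert_of_sexticDictionary_mulCharRho
    (hdictAllRho : ∀ (k : ℤ), k ≠ 0 → (5 : ℤ) ∣ k → (∀ q : ℕ, q.Prime → ¬ ((q : ℤ) ^ 6 ∣ k)) →
      ∀ (ℓ : ℕ) [NeZero ℓ], ℓ.Prime → 5 ≤ ℓ → ¬ (ℓ : ℤ) ∣ k → ¬ 4 ∣ ℓ - 1 → ¬ 5 ∣ ℓ - 1 →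
        IsSquare ((5 : ℕ) : ZMod ℓ) →
      ∀ χ : DirichletCharacter ℂ ℓ, χ.Odd →
      ∃ (e k₁ M' : ℕ) (_ : NeZero M') (Φ₅ : ZMod 5 × ZMod 5 → ℂ) (Ψ W : ℤ × ℤ → ℂ) (L : ℂ → ℂ) (u : ℂ) (N : ℕ),
        1 ≤ e ∧ e ≤ 5 ∧ k.natAbs = 5 ^ e * k₁ ∧ Nat.Coprime 5 M' ∧
        Φ₅ 0 = 0 ∧
        (∀ d d' : ZMod 5 × ZMod 5, Φ₅ (d.1 * d'.2 + d.2 * d'.1 - d.1 * d'.1, d.2 * d'.2 - d.1 * d'.1) = Φ₅ d * Φ₅ d') ∧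
        Φ₅ (-1, 1) = (-(UpperHalfPlane.ρ : ℂ) ^ 2) ^ e ∧
        (∀ y z : ℤ × ℤ, Ψ (y.1 + M' * z.1, y.2 + M' * z.2) = Ψ y) ∧ (∀ y : ℤ × ℤ, IsIntegral ℤ (Ψ y)) ∧
        (∀ y : ℤ × ℤ, W y = Φ₅ ((y.2 : ZMod 5), ((y.1 + y.2 : ℤ) : ZMod 5)) * Ψ y) ∧
        Differentiable ℂ L ∧
        (∀ s : ℂ, 2 < s.re →
          L s = LSeries (fun n : ℕ ↦ χ⁻¹ (n : ZMod ℓ) * ((⟨0, 0, 0, 0, (k : ℚ)⟩ : WeierstrassCurve ℚ).LFunction n : ℂ)) s) ∧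
        IsIntegral ℤ u ∧ ¬ 5 ∣ N ∧
        L 1 = u / N * BinaryTheta.thetaLFunction 3 (2 * (5 * M')) 1 (-((Real.sqrt (3 : ℕ) : ℂ) * I))
          (QuadOrder.parityLift W) 1) :
    ManinDatumSupercuspidalCMInert :=
  maninDatumSupercuspidalCMInert_of_H5 (H5_of_sexticDictionary_mulCharRho hdictAllRho)

end Summit.BirchSwinnertonDyer.BirchSwinnertonDyer.Theorems.BiquadraticEisensteinDescentManinDatumSupercuspidalCMInertOfSexticDictionaryMulCharRho

end
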